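import Literature.AlgebraicGeometry.Resolution.CobordantBlowup
import Literature.AlgebraicGeometry.Resolution.ProjectiveSpaceRegular
import Literature.AlgebraicGeometry.Resolution.AlterationsProofs
import Mathlib.Algebra.MvPolynomial.Equiv
import Mathlib.RingTheory.RegularLocalRing.Polynomial
import HarnessLib

/-!
# Cobordant blow-ups (Włodarczyk 2022), III: the weighted blow-up of affine space,
# `B = 𝔸ⁿ⁺¹`

Topic: `Literature/AlgebraicGeometry/Resolution`. Continuation of `CobordantBlowupAlgebra.lean`
and `CobordantBlowup.lean` (definition request `defn-CobordantBlowup`). Włodarczyk,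
*Functorial resolution by torus actions*, arXiv:2203.03090, Example 2.3.3 ("Weighted blow-up
via cobordism"): for the centre `𝒥 = (x₁^{1/w₁}, …, x_k^{1/w_k})` on affine space
`X = 𝔸ⁿ = Spec R[x₁, …, xₙ]` the full cobordant blow-up is again an affine space,
  `B = Spec R[t⁻¹, t^{w₁} x₁, …, t^{wₙ} xₙ] = Spec R[x₀, x₁', …, xₙ'] = 𝔸ⁿ⁺¹`
(`x₀ = t⁻¹`, `xᵢ' = xᵢ t^{wᵢ}`; coordinates outside the centre are given weight `0`, so that
`xⱼ' = xⱼ` as in §2.3.9), with `B₊ = 𝔸ⁿ⁺¹ ∖ V(x₁', …, xₙ')`, `B₋ = 𝔸ⁿ⁺¹ ∖ V(x₀)`. This is the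
local model of every cobordant blow-up at a regular centre (§2.3.9: "`B` is a regular closed
subscheme of `X × 𝔸ⁿ⁺¹`") and the model used by the route's local crux `LocalWeightedDrop`
(`xᵢ = s^{wᵢ}(cᵢ + yᵢ)` on `B = 𝔸ⁿ⁺¹`). PROVED here:

* `cobordantAlgebra.affineSpaceEquiv R w : MvPolynomial (Option ι) R ≃+* 𝒪_B` for
  `𝒪_B = cobordantAlgebra (X : ι → R[xᵢ : i ∈ ι]) w`, `X_none ↦ s = t⁻¹`, `X_(some i) ↦ xᵢ' = xᵢ t^{wᵢ}`
  (surjective by generation; injective because after `xᵢ ↦ xᵢ t^{-wᵢ}, t ↦ t` the composite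
  `R[x₀, x'] → R[x][t, t⁻¹] → R[x][t, t⁻¹]` is the standard embedding `x₀ ↦ t⁻¹, xᵢ' ↦ xᵢ`);
* `cobordantAlgebra.isRegularRing_affineSpace` — `𝒪_B` is a regular ring when `R` is (and `ι` is
  finite), and `cobordantBlowup.isRegular_affineSpace`, `cobordantBlowup.isRegular_plus_affineSpace`
  — **`B` and `B₊` are regular schemes** (§2.3.9 in the model case; Mathlib: polynomial rings
  over regular rings are regular).

## Sources

* J. Włodarczyk, arXiv:2203.03090 (July 2025 version), Example 2.3.3 (PDF p. 9), §2.3.9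
  (PDF p. 11). [Wlodarczyk2022]
-/

noncomputable section

open scoped LaurentPolynomial
open LaurentPolynomial CategoryTheory AlgebraicGeometry

namespace Literature.AlgebraicGeometry.Resolution

universe u

namespace cobordantAlgebra

variable (R : Type u) [CommRing R] {ι : Type u} (w : ι → ℕ)

/-- The coordinates `X : ι → R[xᵢ : i ∈ ι]` of affine space, the generators of the centre
`(xᵢ^{1/wᵢ} : i ∈ ι)` (weight `0` allowed: such coordinates are not blown up). [folklore] -/
abbrev coord : ι → MvPolynomial ι R := MvPolynomial.X

/-- **Example 2.3.3, the map `R[x₀, x₁', …, xₙ'] → 𝒪_B = R[x][t⁻¹, xᵢ t^{wᵢ}]`**,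
`x₀ = X_none ↦ s = t⁻¹`, `xᵢ' = X_(some i) ↦ xᵢ t^{wᵢ}`; an isomorphism (`affineSpaceEquiv`).
[cite: Wlodarczyk2022, Example 2.3.3] -/
def ofAffineSpace : MvPolynomial (Option ι) R →+* cobordantAlgebra (coord R) w :=
  MvPolynomial.eval₂Hom ((algebraMap (MvPolynomial ι R) (cobordantAlgebra (coord R) w)).comp
    MvPolynomial.C) fun o => o.elim (s (coord R) w) (u' (coord R) w)

/-- `x₀ ↦ s`. [folklore] -/
@[simp] theorem ofAffineSpace_X_none :
    ofAffineSpace R w (MvPolynomial.X none) = s (coord R) w := by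
  simp [ofAffineSpace]

/-- `xᵢ' ↦ xᵢ t^{wᵢ}`. [folklore] -/
@[simp] theorem ofAffineSpace_X_some (i : ι) :
    ofAffineSpace R w (MvPolynomial.X (some i)) = u' (coord R) w i := by
  simp [ofAffineSpace]

/-- Constants go to constants. [folklore] -/
@[simp] theorem ofAffineSpace_C (r : R) :
    ofAffineSpace R w (MvPolynomial.C r) =
      algebraMap (MvPolynomial ι R) (cobordantAlgebra (coord R) w) (MvPolynomial.C r) := by
  simp [ofAffineSpace]

/-- The substitution `xᵢ ↦ x₀^{wᵢ} xᵢ'`, `R[x] → R[x₀, x']`, through which the structure map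
`R[x] → 𝒪_B` factors (`algebraMap_eq_ofAffineSpace_subst`). [folklore] -/
def subst : MvPolynomial ι R →+* MvPolynomial (Option ι) R :=
  MvPolynomial.eval₂Hom MvPolynomial.C fun i =>
    MvPolynomial.X none ^ w i * MvPolynomial.X (some i)

/-- The structure map `R[x] → 𝒪_B` is `R[x] → R[x₀, x'] → 𝒪_B` (`xᵢ = s^{wᵢ} xᵢ'`, §2.3.9).
[cite: Wlodarczyk2022, §2.3.9] -/
theorem algebraMap_eq_ofAffineSpace_comp_subst :
    algebraMap (MvPolynomial ι R) (cobordantAlgebra (coord R) w) = (ofAffineSpace R w).comp (subst R w) := by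
  refine MvPolynomial.ringHom_ext (fun r => ?_) (fun i => ?_)
  · rw [RingHom.comp_apply, subst, MvPolynomial.eval₂Hom_C, ofAffineSpace_C]
  · rw [RingHom.comp_apply, subst, MvPolynomial.eval₂Hom_X', map_mul, map_pow, ofAffineSpace_X_none,
      ofAffineSpace_X_some]
    exact algebraMap_u (coord R) w i

/-- Pointwise form of `algebraMap_eq_ofAffineSpace_comp_subst`. [folklore] -/
theorem algebraMap_eq_ofAffineSpace_subst (a : MvPolynomial ι R) :
    algebraMap (MvPolynomial ι R) (cobordantAlgebra (coord R) w) a = ofAffineSpace R w (subst R w a) :=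
  RingHom.congr_fun (algebraMap_eq_ofAffineSpace_comp_subst R w) a

/-- **`R[x₀, x'] → 𝒪_B` is surjective** (`𝒪_B` is generated by `s`, the `xᵢ'` and `R[x]`, and
`xᵢ = s^{wᵢ} xᵢ'`). [cite: Wlodarczyk2022, Example 2.3.3] -/
theorem ofAffineSpace_surjective : Function.Surjective (ofAffineSpace R w) := by
  intro f
  induction f using induction_on with
  | algebraMap a => exact ⟨subst R w a, (algebraMap_eq_ofAffineSpace_subst R w a).symm⟩
  | s => exact ⟨MvPolynomial.X none, ofAffineSpace_X_none R w⟩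
  | u' i => exact ⟨MvPolynomial.X (some i), ofAffineSpace_X_some R w i⟩
  | add f g hf hg =>
    obtain ⟨P, rfl⟩ := hf
    obtain ⟨Q, rfl⟩ := hg
    exact ⟨P + Q, map_add _ _ _⟩
  | mul f g hf hg =>
    obtain ⟨P, rfl⟩ := hf
    obtain ⟨Q, rfl⟩ := hg
    exact ⟨P * Q, map_mul _ _ _⟩

/-- The "untwisting" `R[x][t, t⁻¹] → R[x][t, t⁻¹]`, `xᵢ ↦ xᵢ t^{-wᵢ}`, `t ↦ t`, which sends
`xᵢ' = xᵢ t^{wᵢ}` back to `xᵢ` and fixes `s = t⁻¹`. [folklore] -/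
def untwist : (MvPolynomial ι R)[T;T⁻¹] →+* (MvPolynomial ι R)[T;T⁻¹] :=
  LaurentPolynomial.eval₂
    (MvPolynomial.eval₂Hom (C.comp MvPolynomial.C) fun i => C (MvPolynomial.X i) * T (-(w i : ℤ)))
    (unitOfInvertible (T 1))

/-- `untwist (t⁻¹) = t⁻¹`. [folklore] -/
theorem untwist_T_neg_one : untwist R w (T (-1)) = T (-1) := by
  rw [untwist, eval₂_T, zpow_neg_one, val_inv_unitOfInvertible, invOf_T]

/-- `untwist (t^n) = t^n` for `n ≥ 0`. [folklore] -/
theorem untwist_T_natCast (n : ℕ) : untwist R w (T (n : ℤ)) = T (n : ℤ) := by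
  rw [untwist, eval₂_T_n, val_unitOfInvertible, T_pow, mul_one]

/-- `untwist` on coefficients `xᵢ`: `xᵢ ↦ xᵢ t^{-wᵢ}`. [folklore] -/
theorem untwist_C_X (i : ι) :
    untwist R w (C (MvPolynomial.X i)) = C (MvPolynomial.X i) * T (-(w i : ℤ)) := by
  rw [untwist, eval₂_C, MvPolynomial.eval₂Hom_X']

/-- `untwist` on constants. [folklore] -/
theorem untwist_C_C (r : R) : untwist R w (C (MvPolynomial.C r)) = C (MvPolynomial.C r) := by
  rw [untwist, eval₂_C, MvPolynomial.eval₂Hom_C, RingHom.comp_apply]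

/-- The standard embedding `R[x₀, x'] → R[x][t, t⁻¹]`, `x₀ ↦ t⁻¹`, `xᵢ' ↦ xᵢ`. [folklore] -/
def stdEmb : MvPolynomial (Option ι) R →+* (MvPolynomial ι R)[T;T⁻¹] :=
  MvPolynomial.eval₂Hom (C.comp MvPolynomial.C) fun o => o.elim (T (-1)) fun i => C (MvPolynomial.X i)

/-- The standard embedding is `invert ∘ toLaurent ∘ optionEquivLeft`. [folklore] -/
theorem stdEmb_eq :
    stdEmb R (ι := ι) = (LaurentPolynomial.invert (R := MvPolynomial ι R)).toAlgHom.toRingHom.comp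
      (Polynomial.toLaurent.comp (MvPolynomial.optionEquivLeft R ι).toAlgHom.toRingHom) := by
  refine MvPolynomial.ringHom_ext (fun r => ?_) (fun o => ?_)
  · simp [stdEmb]
  · cases o with
    | none => simp [stdEmb]
    | some i => simp [stdEmb]

/-- The standard embedding `R[x₀, x'] → R[x][t, t⁻¹]` is injective. [folklore] -/
theorem stdEmb_injective : Function.Injective (stdEmb R (ι := ι)) := by
  rw [stdEmb_eq]
  exact (LaurentPolynomial.invert (R := MvPolynomial ι R)).injective.comp
    (Polynomial.toLaurent_injective.comp (MvPolynomial.optionEquivLeft R ι).injective)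

/-- Untwisting `𝒪_B ⊆ R[x][t, t⁻¹]` after `R[x₀, x'] → 𝒪_B` gives the standard embedding.
[folklore] -/
theorem untwist_comp_ofAffineSpace :
    (untwist R w).comp ((cobordantAlgebra (coord R) w).val.toRingHom.comp (ofAffineSpace R w)) =
      stdEmb R (ι := ι) := by
  refine MvPolynomial.ringHom_ext (fun r => ?_) (fun o => ?_)
  · have hval : (cobordantAlgebra (coord R) w).val.toRingHom
        (algebraMap (MvPolynomial ι R) (cobordantAlgebra (coord R) w) (MvPolynomial.C r)) =
          C (MvPolynomial.C r) := rfl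
    rw [RingHom.comp_apply, RingHom.comp_apply, ofAffineSpace_C, hval, untwist_C_C, stdEmb,
      MvPolynomial.eval₂Hom_C, RingHom.comp_apply]
  · cases o with
    | none =>
      have hval : (cobordantAlgebra (coord R) w).val.toRingHom (s (coord R) w) = T (-1) := rfl
      rw [RingHom.comp_apply, RingHom.comp_apply, ofAffineSpace_X_none, hval, untwist_T_neg_one,
        stdEmb, MvPolynomial.eval₂Hom_X', Option.elim_none]
    | some i =>
      have hval : (cobordantAlgebra (coord R) w).val.toRingHom (u' (coord R) w i) =
          C (MvPolynomial.X i) * T (w i : ℤ) := rfl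
      rw [RingHom.comp_apply, RingHom.comp_apply, ofAffineSpace_X_some, hval, map_mul, untwist_C_X,
        untwist_T_natCast, mul_assoc, ← T_add, neg_add_cancel, T_zero, mul_one, stdEmb,
        MvPolynomial.eval₂Hom_X', Option.elim_some]

/-- **`R[x₀, x'] → 𝒪_B` is injective**: `x₀ = t⁻¹` and the `xᵢ' = xᵢ t^{wᵢ}` are algebraically
independent over `R` in `R[x][t, t⁻¹]`. [cite: Wlodarczyk2022, Example 2.3.3] -/
theorem ofAffineSpace_injective : Function.Injective (ofAffineSpace R w (ι := ι)) := by
  intro F G h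
  apply stdEmb_injective R
  rw [← untwist_comp_ofAffineSpace R w, RingHom.comp_apply, RingHom.comp_apply, h]
  rfl

/-- **Example 2.3.3: the full cobordant blow-up of affine space at a weighted coordinate centre
is affine space**, `R[x₀, x₁', …, xₙ'] ≅ 𝒪_B = R[x₁, …, xₙ][t⁻¹, xᵢ t^{wᵢ}]`
(`x₀ ↦ t⁻¹`, `xᵢ' ↦ xᵢ t^{wᵢ}`): "`B = Spec (k[x₀, …, xₙ]) = Spec (k[t⁻¹, t^{w₁} u₁, …, t^{w_k} u_k])`".
[cite: Wlodarczyk2022, Example 2.3.3] -/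
def affineSpaceEquiv : MvPolynomial (Option ι) R ≃+* cobordantAlgebra (coord R) w :=
  RingEquiv.ofBijective (ofAffineSpace R w) ⟨ofAffineSpace_injective R w, ofAffineSpace_surjective R w⟩

/-- The isomorphism `R[x₀, x'] ≅ 𝒪_B` is the map `ofAffineSpace`. [folklore] -/
@[simp] theorem affineSpaceEquiv_apply (F : MvPolynomial (Option ι) R) :
    affineSpaceEquiv R w F = ofAffineSpace R w F := rfl

/-- **`𝒪_B` is a regular ring** in the model case (`R` regular, e.g. a field or `ℤ`, finitely
many coordinates): it is a polynomial ring over `R` (§2.3.9: "`B` is a regular closed subscheme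
of `X × 𝔸ⁿ⁺¹`"). [cite: Wlodarczyk2022, §2.3.9] -/
theorem isRegularRing_affineSpace [IsRegularRing R] [Finite ι] :
    IsRegularRing (cobordantAlgebra (coord R (ι := ι)) w) :=
  IsRegularRing.of_ringEquiv (affineSpaceEquiv R w)

end cobordantAlgebra

namespace cobordantBlowup

variable (R : Type u) [CommRing R] {ι : Type u} (w : ι → ℕ)

/-- **The full cobordant blow-up `B ≅ 𝔸ⁿ⁺¹_R` of a weighted coordinate centre on `𝔸ⁿ_R` is a
regular scheme** for `R` regular (Włodarczyk, Example 2.3.3 with §2.3.9).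
[cite: Wlodarczyk2022, §2.3.9] -/
theorem isRegular_affineSpace [IsRegularRing R] [Finite ι] :
    Scheme.IsRegular (cobordantBlowup (cobordantAlgebra.coord R (ι := ι)) w) := by
  haveI := cobordantAlgebra.isRegularRing_affineSpace R w (ι := ι)
  exact Scheme.isRegular_Spec (.of _)

/-- **The cobordant blow-up `B₊ = 𝔸ⁿ⁺¹ ∖ V(x₁', …, xₙ')` is a regular scheme** for `R` regular
(an open subscheme of the regular `B`). [cite: Wlodarczyk2022, §2.3.9] -/
theorem isRegular_plus_affineSpace [IsRegularRing R] [Finite ι] :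
    Scheme.IsRegular (plus (cobordantAlgebra.coord R (ι := ι)) w : Scheme.{u}) :=
  Scheme.IsRegular.of_isOpenImmersion (plus (cobordantAlgebra.coord R (ι := ι)) w).ι
    (isRegular_affineSpace R w)

end cobordantBlowup

end Literature.AlgebraicGeometry.Resolution
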